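import Summits.QuantumFields.QCD.Theorems.QuarksAsStableActionStableActionBridgeStubSliceDataSuConj
import Summits.QuantumFields.QCD.Theorems.QuarksAsStableActionStableActionBridgeStubBondKernelContinuous
import Summits.QuantumFields.QCD.Theorems.QuarksAsStableActionStableActionBridgeStubRayleighOfInvariant
import HarnessLib

/-!
# The Gauss-averaged gauge bond kernel is charge-conjugation covariant
(stub `stub_bondKernel_chargeConj` of line `twisted_trace_transfer` for crux
`QuarksAsStableAction.StableActionBridge`, item stmt-QuantumFields-9737, `--supports`; sub-goal V3)

To prove that the vacuum of Lüscher's transfer matrix of lattice QCD is fermion-even, the line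
`twisted_trace_transfer` uses charge conjugation `𝒱` (particle–hole conjugation times a spin rotation on the
slice Fock space) combined with complex conjugation `U ↦ Ū` (`suConj 3`) of all link variables.  The kernel of
the transfer operator contains the Gauss-averaged Wilson gauge bond matrix

  `B(U, U')_{a c} = ∫ K_β(U, U'^g) Γ(G_g)_{a c} dg`

(integral over the temporal links `g : sites → SU(3)` against the product Haar probability measure;
`K_β = gaugeSliceKernel β`, `U'^g = gaugeTransform g U'`, `Γ(G_g) = fockGaugeAct g`).  This file proves its
charge-conjugation covariance: for ANY matrix `V` intertwining the Fock gauge rotations with their charge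
conjugates, `Γ(G_g) V = V Γ(G_{ḡ})` for all `g` (`ḡ x := suConj 3 (g x)`), one has

  `B(U, U') V = V B(Ū, Ū')`.

Proof (entrywise).  `(B(U,U') V)_{a d} = Σ_c (∫ K(U,U'^g) Γ(g)_{a c} dg) V_{c d} = ∫ K(U,U'^g) (Γ(g) V)_{a d} dg`
(finite sums commute with the integral; the integrands are continuous on the compact group of temporal links,
hence integrable, `StubRayleighOfInvariant.integrable_bondIntegrand`) `= ∫ K(U,U'^g) (V Γ(ḡ))_{a d} dg`
(hypothesis).  Now `K(U, U'^g) = K(Ū, (U'^g)‾)` and `(U'^g)‾ = Ū'^{ḡ}` (clauses (1), (2) of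
`stub_sliceData_suConj`), so the integrand is `F(ḡ)` with `F h := K(Ū, Ū'^h) (V Γ(h))_{a d}`; the involution
`g ↦ ḡ` preserves the product Haar measure (clause (5) of `stub_sliceData_suConj`), whence
`∫ F(ḡ) dg = ∫ F(h) dh = Σ_c V_{a c} B(Ū,Ū')_{c d}` (`MeasurePreserving.integral_comp` along the measurable
involution `MeasurableEquiv.ofInvolutive`).

Pure theorem file (no definitions, no local notation: `SU(3)` is spelled `Matrix.specialUnitaryGroup (Fin 3) ℂ`);
helpers in the sub-namespace `StubBondKernelChargeConj`.

[cite: Smit2023, §4.6 (4.121)–(4.129)] [cite: LuciniEtAl2016, §6]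
-/

noncomputable section

open MeasureTheory
open scoped Matrix BigOperators ComplexConjugate
open Literature.MathematicalPhysics.QuantumFieldTheory Literature.MathematicalPhysics.QuantumLattice
open Literature.Probability.LatticeModels (TorusSite)

namespace Summit.QuantumFields.QCD.Cruxes.StableActionBridge.TwistedTraceTransfer

namespace StubBondKernelChargeConj

/-! ### Finite sums through an integral -/

/-- `Σ_c (∫ F(g)_c dν) w_c = ∫ Σ_c F(g)_c w_c dν` for finitely many integrable `F(·)_c` (right
multiplication of a row of integrals by a column vector). [folklore] -/
theorem sum_integral_mul {A : Type*} [MeasurableSpace A] {ν : Measure A} {n : Type*} [Fintype n]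
    {F : A → n → ℂ} (hF : ∀ c, Integrable (fun g => F g c) ν) (w : n → ℂ) :
    ∑ c, (∫ g, F g c ∂ν) * w c = ∫ g, ∑ c, F g c * w c ∂ν := by
  rw [integral_finsetSum _ fun c _ => (hF c).mul_const (w c)]
  exact Finset.sum_congr rfl fun c _ => (integral_mul_const (w c) _).symm

/-- `Σ_c w_c (∫ F(g)_c dν) = ∫ Σ_c w_c F(g)_c dν` for finitely many integrable `F(·)_c` (left
multiplication of a column of integrals by a row vector). [folklore] -/
theorem sum_mul_integral {A : Type*} [MeasurableSpace A] {ν : Measure A} {n : Type*} [Fintype n]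
    {F : A → n → ℂ} (hF : ∀ c, Integrable (fun g => F g c) ν) (w : n → ℂ) :
    ∑ c, w c * (∫ g, F g c ∂ν) = ∫ g, ∑ c, w c * F g c ∂ν := by
  rw [integral_finsetSum _ fun c _ => (hF c).const_mul (w c)]
  exact Finset.sum_congr rfl fun c _ => (integral_const_mul (w c) _).symm

/-! ### The charge-conjugation involution on the temporal links -/

/-- `g ↦ ḡ` (pointwise `suConj 3`) is an involution of the temporal links. [folklore] -/
theorem involutive_piSuConj (ι : Type*) (N : ℕ) :
    Function.Involutive (fun g : ι → Matrix.specialUnitaryGroup (Fin N) ℂ => fun x => suConj N (g x)) :=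
  fun g => funext fun x => suConj_suConj N (g x)

/-- `g ↦ ḡ` is a measurable embedding of the temporal links (a measurable involution). [folklore] -/
theorem measurableEmbedding_piSuConj (ι : Type*) [Fintype ι] (N : ℕ) :
    MeasurableEmbedding (fun g : ι → Matrix.specialUnitaryGroup (Fin N) ℂ => fun x => suConj N (g x)) :=
  (MeasurableEquiv.ofInvolutive _ (involutive_piSuConj ι N)
    (StubSliceDataSuConj.measurePreserving_pi_suConj ι N).measurable).measurableEmbedding

/-- **Change of variables `g ↦ ḡ` in the Gauss average**: `∫ F(ḡ) dg = ∫ F(g) dg` for the product Haar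
probability measure on the temporal links (charge conjugation preserves Haar measure). [folklore] -/
theorem integral_comp_piSuConj (ι : Type*) [Fintype ι] (N : ℕ)
    (F : (ι → Matrix.specialUnitaryGroup (Fin N) ℂ) → ℂ) :
    ∫ g, F (fun x => suConj N (g x)) ∂(Measure.pi fun _ => haarProbability (Matrix.specialUnitaryGroup (Fin N) ℂ)) =
      ∫ g, F g ∂(Measure.pi fun _ => haarProbability (Matrix.specialUnitaryGroup (Fin N) ℂ)) :=
  (StubSliceDataSuConj.measurePreserving_pi_suConj ι N).integral_comp (measurableEmbedding_piSuConj ι N) F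

end StubBondKernelChargeConj

/-- **Sub-goal V3 (registered stub `stub_bondKernel_chargeConj`): the Gauss-averaged bond kernel is charge-conjugation covariant** —
for ANY matrix `V` intertwining the Fock gauge rotations with their charge conjugates (`Γ(G_g) V = V Γ(G_{ḡ})`, e.g. `V = P_hᴴ Γ(1 ⊗ w)`):
`B(U,U') V = V B(Ū, Ū')` (kernel and gauge action are `suConj`-invariant and Haar on the temporal links is `suConj`-invariant,
`stub_sliceData_suConj`; finite sums commute with the Gauss average). [folklore] -/
theorem stub_bondKernel_chargeConj : ∀ (Nf S : ℕ) [NeZero S] (β : ℝ) (V : Matrix (Finset (SliceFermiIdx Nf S)) (Finset (SliceFermiIdx Nf S)) ℂ),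
    (∀ g : TorusSite 3 S → (Matrix.specialUnitaryGroup (Fin 3) ℂ), @fockGaugeAct Nf S _ g * V = V * @fockGaugeAct Nf S _ (fun x => suConj 3 (g x))) →
    ∀ U U' : GaugeConfig 3 S (Matrix.specialUnitaryGroup (Fin 3) ℂ),
      (Matrix.of fun a c => ∫ g : TorusSite 3 S → (Matrix.specialUnitaryGroup (Fin 3) ℂ),
            (gaugeSliceKernel β U (gaugeTransform g U') : ℂ) * @fockGaugeAct Nf S _ g a c
              ∂(Measure.pi fun _ => haarProbability (Matrix.specialUnitaryGroup (Fin 3) ℂ))) * V =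
      V * (Matrix.of fun a c => ∫ g : TorusSite 3 S → (Matrix.specialUnitaryGroup (Fin 3) ℂ),
            (gaugeSliceKernel β (fun e => suConj 3 (U e)) (gaugeTransform g (fun e => suConj 3 (U' e))) : ℂ) * @fockGaugeAct Nf S _ g a c
              ∂(Measure.pi fun _ => haarProbability (Matrix.specialUnitaryGroup (Fin 3) ℂ))) := by
  intro Nf S _ β V hV U U'
  obtain ⟨hK, hT, -, -, -⟩ := stub_sliceData_suConj Nf S β
  ext a d
  simp only [Matrix.mul_apply, Matrix.of_apply]
  calc ∑ c, (∫ g : TorusSite 3 S → (Matrix.specialUnitaryGroup (Fin 3) ℂ),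
            (gaugeSliceKernel β U (gaugeTransform g U') : ℂ) * @fockGaugeAct Nf S _ g a c
              ∂(Measure.pi fun _ => haarProbability (Matrix.specialUnitaryGroup (Fin 3) ℂ))) * V c d
      = ∫ g : TorusSite 3 S → (Matrix.specialUnitaryGroup (Fin 3) ℂ),
            (gaugeSliceKernel β U (gaugeTransform g U') : ℂ) * (@fockGaugeAct Nf S _ g * V) a d
              ∂(Measure.pi fun _ => haarProbability (Matrix.specialUnitaryGroup (Fin 3) ℂ)) := by
        rw [StubBondKernelChargeConj.sum_integral_mul
          fun c => StubRayleighOfInvariant.integrable_bondIntegrand β U U' a c]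
        refine integral_congr_ae (Filter.Eventually.of_forall fun g => ?_)
        simp only [Matrix.mul_apply, Finset.mul_sum, mul_assoc]
    _ = ∫ g : TorusSite 3 S → (Matrix.specialUnitaryGroup (Fin 3) ℂ),
            (gaugeSliceKernel β U (gaugeTransform g U') : ℂ) *
              (V * @fockGaugeAct Nf S _ (fun x => suConj 3 (g x))) a d
              ∂(Measure.pi fun _ => haarProbability (Matrix.specialUnitaryGroup (Fin 3) ℂ)) := by
        simp_rw [hV]
    _ = ∫ g : TorusSite 3 S → (Matrix.specialUnitaryGroup (Fin 3) ℂ),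
            (gaugeSliceKernel β (fun e => suConj 3 (U e))
                (gaugeTransform (fun x => suConj 3 (g x)) (fun e => suConj 3 (U' e))) : ℂ) *
              (V * @fockGaugeAct Nf S _ (fun x => suConj 3 (g x))) a d
              ∂(Measure.pi fun _ => haarProbability (Matrix.specialUnitaryGroup (Fin 3) ℂ)) := by
        refine integral_congr_ae (Filter.Eventually.of_forall fun g => ?_)
        beta_reduce
        rw [hT g U', hK U (gaugeTransform g U')]
    _ = ∫ g : TorusSite 3 S → (Matrix.specialUnitaryGroup (Fin 3) ℂ),
            (gaugeSliceKernel β (fun e => suConj 3 (U e)) (gaugeTransform g (fun e => suConj 3 (U' e))) : ℂ) *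
              (V * @fockGaugeAct Nf S _ g) a d
              ∂(Measure.pi fun _ => haarProbability (Matrix.specialUnitaryGroup (Fin 3) ℂ)) :=
        StubBondKernelChargeConj.integral_comp_piSuConj (TorusSite 3 S) 3
          fun h => (gaugeSliceKernel β (fun e => suConj 3 (U e))
            (gaugeTransform h (fun e => suConj 3 (U' e))) : ℂ) * (V * @fockGaugeAct Nf S _ h) a d
    _ = ∑ c, V a c * ∫ g : TorusSite 3 S → (Matrix.specialUnitaryGroup (Fin 3) ℂ),
            (gaugeSliceKernel β (fun e => suConj 3 (U e)) (gaugeTransform g (fun e => suConj 3 (U' e))) : ℂ) *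
              @fockGaugeAct Nf S _ g c d
              ∂(Measure.pi fun _ => haarProbability (Matrix.specialUnitaryGroup (Fin 3) ℂ)) := by
        rw [StubBondKernelChargeConj.sum_mul_integral
          fun c => StubRayleighOfInvariant.integrable_bondIntegrand β (fun e => suConj 3 (U e))
            (fun e => suConj 3 (U' e)) c d]
        refine integral_congr_ae (Filter.Eventually.of_forall fun g => ?_)
        simp only [Matrix.mul_apply, Finset.mul_sum]
        exact Finset.sum_congr rfl fun c _ => by ring

end Summit.QuantumFields.QCD.Cruxes.StableActionBridge.TwistedTraceTransfer

end
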